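import Summits.QuantumFields.YangMills.Theorems.ChatterjeeMassGapTorusAxialDistanceTwoSlabs
import HarnessLib

/-!
# Support rigidity for the distance-two coplanar pair, II: the count (item 8941 lane)

Seat ym-dw-p1 g8 (target T2 of ym-idea-4 g7). Part I (`S28DistanceTwo.four_in_slab`,
`exists_slab_one`) gives, in a connected family `T ∋ A, B₂` without private bonds, four temporal
plaquettes in each of the slabs `0, 1, 2`. Here the budget `#T ≤ 14` is spent: the bond `(0, 1)`
under `A` and the bond `(3e₀, 1)` over `B₂` need second plaquettes `c₀, c₃`; a temporal one would
bring four more temporal plaquettes in slab `-1` or `3` (sixteen members), so `c₀` is one of the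
four spatial plaquettes through `(0,1)` and `c₃` one of the four through `(3e₀,1)`, and
`T = S₀ ⊔ S₁ ⊔ S₂ ⊔ {c₀, c₃}` exactly (**`core`**): every member of `T` is temporal in a slab
`0, 1, 2`, or is `c₀`, or is `c₃`. Part III pins the tube from this. Pure lattice combinatorics;
no statement about Gibbs states; no mass gap is claimed.
-/

noncomputable section

open Finset
open Literature.MathematicalPhysics.QuantumLattice (ZdEdge ZdPlaquette plaquetteEdges plaquettesTouching
  mem_plaquettesTouching_iff)
open Literature.MathematicalPhysics.QuantumFieldTheory (LinkAdj)
open Literature.Probability.LatticeModels (Site)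
open Summit.QuantumFields.YangMills.Theorems.S28OneBitBox (lt01 lt02 lt12)
open Summit.QuantumFields.YangMills.Theorems.S28AdjacentPair (lt03 lt13)

namespace Summit.QuantumFields.YangMills.Theorems.S28DistanceTwo

/-- The plaquettes of `ℤ⁴` through the bond `(0, 1)` under `A`: `A`, the temporal plaquette of
slab `-1` below it, and the four spatial bottom caps (kernel computation). -/
theorem touching_bottom :
    plaquettesTouching ({((![0,0,0,0] : Site 4), (1 : Fin 4))} : Finset (ZdEdge 4)) =
      ({(![0,0,0,0], ⟨(0, 1), lt01⟩), (![-1,0,0,0], ⟨(0, 1), lt01⟩), (![0,0,0,0], ⟨(1, 2), lt12⟩),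
        (![0,0,-1,0], ⟨(1, 2), lt12⟩), (![0,0,0,0], ⟨(1, 3), lt13⟩), (![0,0,0,-1], ⟨(1, 3), lt13⟩)} :
        Finset (ZdPlaquette 4)) := by
  decide +kernel

/-- The plaquettes of `ℤ⁴` through the bond `(3e₀, 1)` over `B₂`: `B₂`, the temporal plaquette of
slab `3` above it, and the four spatial top caps (kernel computation). -/
theorem touching_top :
    plaquettesTouching ({((![3,0,0,0] : Site 4), (1 : Fin 4))} : Finset (ZdEdge 4)) =
      ({(![2,0,0,0], ⟨(0, 1), lt01⟩), (![3,0,0,0], ⟨(0, 1), lt01⟩), (![3,0,0,0], ⟨(1, 2), lt12⟩),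
        (![3,0,-1,0], ⟨(1, 2), lt12⟩), (![3,0,0,0], ⟨(1, 3), lt13⟩), (![3,0,0,-1], ⟨(1, 3), lt13⟩)} :
        Finset (ZdPlaquette 4)) := by
  decide +kernel

/-- **The count.** In a family `T` of at most fourteen plaquettes through `A = (0;0,1)` and
`B₂ = (2e₀;0,1)` without private bonds and with a temporal plaquette in slab `1`, there are a
bottom cap `c₀` (a spatial plaquette through `(0,1)`) and a top cap `c₃` (a spatial plaquette
through `(3e₀,1)`) in `T` such that every member of `T` is temporal in one of the slabs `0, 1, 2`,
or is `c₀`, or is `c₃`. [folklore] -/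
theorem core (T : Finset (ZdPlaquette 4))
    (hA : ((![0,0,0,0], ⟨(0, 1), lt01⟩) : ZdPlaquette 4) ∈ T)
    (hB : ((![2,0,0,0], ⟨(0, 1), lt01⟩) : ZdPlaquette 4) ∈ T) (hcard : T.card ≤ 14)
    (hN : ∀ p ∈ T, ∀ ℓ ∈ plaquetteEdges p, ∃ p' ∈ T, p' ≠ p ∧ ℓ ∈ plaquetteEdges p')
    (h1 : ∃ p ∈ T, p.2.1.1 = 0 ∧ p.1 0 = 1) :
    ∃ c₀ ∈ ({(![0,0,0,0], ⟨(1, 2), lt12⟩), (![0,0,-1,0], ⟨(1, 2), lt12⟩), (![0,0,0,0], ⟨(1, 3), lt13⟩),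
        (![0,0,0,-1], ⟨(1, 3), lt13⟩)} : Finset (ZdPlaquette 4)),
      ∃ c₃ ∈ ({(![3,0,0,0], ⟨(1, 2), lt12⟩), (![3,0,-1,0], ⟨(1, 2), lt12⟩), (![3,0,0,0], ⟨(1, 3), lt13⟩),
          (![3,0,0,-1], ⟨(1, 3), lt13⟩)} : Finset (ZdPlaquette 4)),
        c₀ ∈ T ∧ c₃ ∈ T ∧
          ∀ r ∈ T, (r.2.1.1 = 0 ∧ (r.1 0 = 0 ∨ r.1 0 = 1 ∨ r.1 0 = 2)) ∨ r = c₀ ∨ r = c₃ := by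
  classical
  obtain ⟨p₁, hp₁, ht₁, hk₁⟩ := h1
  obtain ⟨S₀, hS₀T, hS₀c, hS₀⟩ := four_in_slab T hN hA rfl
  obtain ⟨S₁, hS₁T, hS₁c, hS₁⟩ := four_in_slab T hN hp₁ ht₁
  obtain ⟨S₂, hS₂T, hS₂c, hS₂⟩ := four_in_slab T hN hB rfl
  have hS₀' : ∀ q ∈ S₀, q.2.1.1 = 0 ∧ q.1 0 = 0 := fun q hq => by
    have h := hS₀ q hq; simpa using h
  have hS₁' : ∀ q ∈ S₁, q.2.1.1 = 0 ∧ q.1 0 = 1 := fun q hq => by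
    obtain ⟨a, b⟩ := hS₁ q hq; exact ⟨a, b.trans hk₁⟩
  have hS₂' : ∀ q ∈ S₂, q.2.1.1 = 0 ∧ q.1 0 = 2 := fun q hq => by
    have h := hS₂ q hq; simpa using h
  have hd01 : Disjoint S₀ S₁ := Finset.disjoint_left.2 fun q h0 h1 => by
    have := (hS₀' q h0).2; have := (hS₁' q h1).2; omega
  have hd02 : Disjoint S₀ S₂ := Finset.disjoint_left.2 fun q h0 h1 => by
    have := (hS₀' q h0).2; have := (hS₂' q h1).2; omega
  have hd12 : Disjoint S₁ S₂ := Finset.disjoint_left.2 fun q h0 h1 => by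
    have := (hS₁' q h0).2; have := (hS₂' q h1).2; omega
  have hU12 : (S₀ ∪ S₁ ∪ S₂).card = 12 := by
    rw [Finset.card_union_of_disjoint (Finset.disjoint_union_left.2 ⟨hd02, hd12⟩),
      Finset.card_union_of_disjoint hd01]
    omega
  have hUT : S₀ ∪ S₁ ∪ S₂ ⊆ T := Finset.union_subset (Finset.union_subset hS₀T hS₁T) hS₂T
  have hmemU : ∀ q ∈ S₀ ∪ S₁ ∪ S₂, q.2.1.1 = 0 ∧ (q.1 0 = 0 ∨ q.1 0 = 1 ∨ q.1 0 = 2) := by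
    intro q hq
    rcases Finset.mem_union.1 hq with hq | hq
    · rcases Finset.mem_union.1 hq with hq | hq
      · exact ⟨(hS₀' q hq).1, Or.inl (hS₀' q hq).2⟩
      · exact ⟨(hS₁' q hq).1, Or.inr (Or.inl (hS₁' q hq).2)⟩
    · exact ⟨(hS₂' q hq).1, Or.inr (Or.inr (hS₂' q hq).2)⟩
  -- a fifth slab would exceed the budget
  have no_extra : ∀ p ∈ T, p.2.1.1 = 0 → (p.1 0 = 0 ∨ p.1 0 = 1 ∨ p.1 0 = 2) := by
    intro p hp ht
    by_contra hk
    push Not at hk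
    obtain ⟨S', hS'T, hS'c, hS'⟩ := four_in_slab T hN hp ht
    have hd' : Disjoint S' (S₀ ∪ S₁ ∪ S₂) := Finset.disjoint_left.2 fun q h' hU => by
      have h1 := (hS' q h').2
      obtain ⟨-, h2⟩ := hmemU q hU
      omega
    have h16 : (S' ∪ (S₀ ∪ S₁ ∪ S₂)).card = 16 := by
      rw [Finset.card_union_of_disjoint hd', hS'c, hU12]
    have := Finset.card_le_card (Finset.union_subset hS'T hUT)
    omega
  -- the bottom cap
  obtain ⟨c₀, hc₀T, hc₀ne, hc₀ℓ⟩ := hN _ hA (((![0,0,0,0] : Site 4), (1 : Fin 4))) (by decide +kernel)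
  have hc₀6 : c₀ ∈ ({(![0,0,0,0], ⟨(0, 1), lt01⟩), (![-1,0,0,0], ⟨(0, 1), lt01⟩), (![0,0,0,0], ⟨(1, 2), lt12⟩),
        (![0,0,-1,0], ⟨(1, 2), lt12⟩), (![0,0,0,0], ⟨(1, 3), lt13⟩), (![0,0,0,-1], ⟨(1, 3), lt13⟩)} :
        Finset (ZdPlaquette 4)) := by
    rw [← touching_bottom]
    exact mem_plaquettesTouching_iff.2 ⟨_, Finset.mem_inter.2 ⟨hc₀ℓ, Finset.mem_singleton_self _⟩⟩
  rw [Finset.mem_insert, Finset.mem_insert] at hc₀6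
  have hc₀C : c₀ ∈ ({(![0,0,0,0], ⟨(1, 2), lt12⟩), (![0,0,-1,0], ⟨(1, 2), lt12⟩), (![0,0,0,0], ⟨(1, 3), lt13⟩),
        (![0,0,0,-1], ⟨(1, 3), lt13⟩)} : Finset (ZdPlaquette 4)) := by
    rcases hc₀6 with h | h | h
    · exact absurd h hc₀ne
    · exfalso
      have := no_extra c₀ hc₀T (by rw [h])
      rw [h] at this
      simp at this
    · exact h
  -- the top cap
  obtain ⟨c₃, hc₃T, hc₃ne, hc₃ℓ⟩ := hN _ hB (((![3,0,0,0] : Site 4), (1 : Fin 4))) (by decide +kernel)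
  have hc₃6 : c₃ ∈ ({(![2,0,0,0], ⟨(0, 1), lt01⟩), (![3,0,0,0], ⟨(0, 1), lt01⟩), (![3,0,0,0], ⟨(1, 2), lt12⟩),
        (![3,0,-1,0], ⟨(1, 2), lt12⟩), (![3,0,0,0], ⟨(1, 3), lt13⟩), (![3,0,0,-1], ⟨(1, 3), lt13⟩)} :
        Finset (ZdPlaquette 4)) := by
    rw [← touching_top]
    exact mem_plaquettesTouching_iff.2 ⟨_, Finset.mem_inter.2 ⟨hc₃ℓ, Finset.mem_singleton_self _⟩⟩
  rw [Finset.mem_insert, Finset.mem_insert] at hc₃6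
  have hc₃C : c₃ ∈ ({(![3,0,0,0], ⟨(1, 2), lt12⟩), (![3,0,-1,0], ⟨(1, 2), lt12⟩), (![3,0,0,0], ⟨(1, 3), lt13⟩),
        (![3,0,0,-1], ⟨(1, 3), lt13⟩)} : Finset (ZdPlaquette 4)) := by
    rcases hc₃6 with h | h | h
    · exact absurd h hc₃ne
    · exfalso
      have := no_extra c₃ hc₃T (by rw [h])
      rw [h] at this
      simp at this
    · exact h
  -- the caps are spatial and distinct
  have hC0sp : ∀ c ∈ ({(![0,0,0,0], ⟨(1, 2), lt12⟩), (![0,0,-1,0], ⟨(1, 2), lt12⟩), (![0,0,0,0], ⟨(1, 3), lt13⟩),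
        (![0,0,0,-1], ⟨(1, 3), lt13⟩)} : Finset (ZdPlaquette 4)), c.2.1.1 ≠ 0 := by decide +kernel
  have hC3sp : ∀ c ∈ ({(![3,0,0,0], ⟨(1, 2), lt12⟩), (![3,0,-1,0], ⟨(1, 2), lt12⟩), (![3,0,0,0], ⟨(1, 3), lt13⟩),
        (![3,0,0,-1], ⟨(1, 3), lt13⟩)} : Finset (ZdPlaquette 4)), c.2.1.1 ≠ 0 := by decide +kernel
  have hC03 : ∀ c ∈ ({(![0,0,0,0], ⟨(1, 2), lt12⟩), (![0,0,-1,0], ⟨(1, 2), lt12⟩), (![0,0,0,0], ⟨(1, 3), lt13⟩),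
        (![0,0,0,-1], ⟨(1, 3), lt13⟩)} : Finset (ZdPlaquette 4)),
      ∀ c' ∈ ({(![3,0,0,0], ⟨(1, 2), lt12⟩), (![3,0,-1,0], ⟨(1, 2), lt12⟩), (![3,0,0,0], ⟨(1, 3), lt13⟩),
        (![3,0,0,-1], ⟨(1, 3), lt13⟩)} : Finset (ZdPlaquette 4)), c ≠ c' := by decide +kernel
  have hc₀U : c₀ ∉ S₀ ∪ S₁ ∪ S₂ := fun h => hC0sp c₀ hc₀C (hmemU c₀ h).1
  have hc₃U : c₃ ∉ S₀ ∪ S₁ ∪ S₂ := fun h => hC3sp c₃ hc₃C (hmemU c₃ h).1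
  have hne : c₀ ≠ c₃ := hC03 _ hc₀C _ hc₃C
  have hUc : (insert c₀ (insert c₃ (S₀ ∪ S₁ ∪ S₂))).card = 14 := by
    rw [Finset.card_insert_of_notMem, Finset.card_insert_of_notMem hc₃U, hU12]
    simp only [Finset.mem_insert, not_or]
    exact ⟨hne, hc₀U⟩
  have hUT' : insert c₀ (insert c₃ (S₀ ∪ S₁ ∪ S₂)) ⊆ T :=
    Finset.insert_subset hc₀T (Finset.insert_subset hc₃T hUT)
  have hTU : insert c₀ (insert c₃ (S₀ ∪ S₁ ∪ S₂)) = T :=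
    Finset.eq_of_subset_of_card_le hUT' (by rw [hUc]; exact hcard)
  refine ⟨c₀, hc₀C, c₃, hc₃C, hc₀T, hc₃T, fun r hr => ?_⟩
  rw [← hTU, Finset.mem_insert, Finset.mem_insert] at hr
  rcases hr with h | h | hr
  · exact Or.inr (Or.inl h)
  · exact Or.inr (Or.inr h)
  · exact Or.inl (hmemU r hr)

end Summit.QuantumFields.YangMills.Theorems.S28DistanceTwo

end
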